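import Summits.FinalStateConjecture.FinalStateConjecture.Theorems.BartnikGapSettlingBondiBartnikRigiditySlabCauchyRigidityDefs
import Mathlib.Analysis.Convex.Topology
import HarnessLib

/-!
# F1' `stub_slabCauchyRigidity'`, step (c), connectedness: the open slab and its lens are connected —
# line `direct-method-on-the-cone`, crux `BondiBartnikRigidity` (stmt-FinalStateConjecture-10807);
# module 2 of the landing of the conditional proof of F1'

Route statement (C) `F1Route.KerrSlabLensCauchy` (`…SlabCauchyRigidityDefs.lean`), its two
connectedness clauses: the open thick slab `slabW M a = {M < r(0,·) < 3M}` of the Kerr–Schild slice is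
connected (`isConnected_slabW`: it is the image of `(M, 3M) × S²` under the oblate spheroidal
parametrisation), and the lens `lensK M a` of the star chart is connected (`isConnected_lensK`: each
point is joined to its foot point `(0, x⃗)` on the slab by the vertical coordinate segment, along which
the three lens functions are affine in `t*`).  The Cauchy and chronology clauses are the companion module
`…SlabCauchyRigidityLensCauchy.lean`.

References: O'Neill 1995, The geometry of Kerr black holes, Ch. 2 §2.1 [ONeill1995].  No
definitions, no named facts.
-/

noncomputable section

-- D-0017: single-problem summit, `Summit.<S>.<S>.…` by design (cf. lakefile `weak.linter.dupNamespace`).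
set_option linter.dupNamespace false

open Set Filter Function Topology TopologicalSpace
open Literature.Geometry.Lorentzian
open scoped Manifold ContDiff Topology RealInnerProductSpace

namespace Summit.FinalStateConjecture.FinalStateConjecture.Theorems.BondiBartnikRigidity.DirectMethod

namespace F1Route

section Connected

/-- The open shell `{M < r(0,·) < 3M}` of `E3` is the image of `(M, 3M) × S²` under the oblate
spheroidal parametrisation, hence connected (`0 < M`). [cite: ONeill1995, Ch. 2 §2.1] -/
theorem isConnected_shell {M : ℝ} (a : ℝ) (hM : 0 < M) :
    IsConnected {y : E3 | M < Kerr.radius a (E4.ofTimeSpace 0 y) ∧ Kerr.radius a (E4.ofTimeSpace 0 y) < 3 * M} := by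
  have heq : {y : E3 | M < Kerr.radius a (E4.ofTimeSpace 0 y) ∧ Kerr.radius a (E4.ofTimeSpace 0 y) < 3 * M} =
      (fun p : ℝ × E3 ↦ (WithLp.toLp 2
        ![√(p.1 ^ 2 + a ^ 2) * p.2 0, √(p.1 ^ 2 + a ^ 2) * p.2 1, p.1 * p.2 2] : E3)) ''
        (Ioo M (3 * M) ×ˢ Metric.sphere (0 : E3) 1) := by
    ext y
    constructor
    · rintro ⟨h1, h2⟩
      have hy : y ∈ {y : E3 | M < Kerr.radius a (E4.ofTimeSpace 0 y)} := h1
      rw [Kerr.slice_eq_image_spheroidal a hM.le] at hy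
      obtain ⟨⟨r, w⟩, ⟨hr, hw⟩, rfl⟩ := hy
      rw [mem_sphere_zero_iff_norm] at hw
      rw [Kerr.radius_spheroidal (hM.trans hr) hw] at h2
      exact ⟨(r, w), ⟨⟨hr, h2⟩, mem_sphere_zero_iff_norm.2 hw⟩, rfl⟩
    · rintro ⟨⟨r, w⟩, ⟨⟨hr1, hr2⟩, hw⟩, rfl⟩
      rw [mem_sphere_zero_iff_norm] at hw
      simp only [mem_setOf_eq]
      rw [Kerr.radius_spheroidal (hM.trans hr1) hw]
      exact ⟨hr1, hr2⟩
  rw [heq]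
  exact ((isConnected_Ioo (by linarith)).prod Kerr.isConnected_sphere_E3).image _
    (Kerr.continuous_spheroidal a).continuousOn

/-- **(C1)** The open slab `slabW` is connected. [cite: ONeill1995, Ch. 2 §2.1] -/
theorem isConnected_slabW {M : ℝ} (a : ℝ) (hM : 0 < M) : IsConnected (slabW M a : Set (Kerr.slice a M)) := by
  have himg : Subtype.val '' (slabW M a : Set (Kerr.slice a M)) =
      {y : E3 | M < Kerr.radius a (E4.ofTimeSpace 0 y) ∧ Kerr.radius a (E4.ofTimeSpace 0 y) < 3 * M} := by
    ext y
    constructor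
    · rintro ⟨z, hz, rfl⟩
      have h1 : max M 0 < Kerr.radius a (E4.ofTimeSpace 0 (z : E3)) := z.2
      rw [max_eq_left hM.le] at h1
      exact ⟨h1, hz⟩
    · rintro ⟨h1, h2⟩
      have hmem : y ∈ Kerr.slice a M := by
        show max M 0 < Kerr.radius a (E4.ofTimeSpace 0 y)
        rw [max_eq_left hM.le]; exact h1
      exact ⟨⟨y, hmem⟩, h2, rfl⟩
  refine ⟨?_, IsInducing.subtypeVal.isPreconnected_image.mp ?_⟩
  · obtain ⟨y, hy⟩ := (isConnected_shell a hM).nonempty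
    rw [← himg] at hy
    obtain ⟨z, hz, -⟩ := hy
    exact ⟨z, hz⟩
  · have h := (isConnected_shell a hM).isPreconnected
    rw [← himg] at h
    exact h

/-- **(C2)** The lens is connected: every point `x` of it is joined inside it to the slab point
`(0, x⃗)` by the vertical coordinate segment (the three lens functions are affine in `t*` along it),
and the slab `{0} × shell` is connected. [folklore] -/
theorem isConnected_lensK {M : ℝ} (a : ℝ) (hM : 0 < M) : IsConnected (lensK M a) := by
  -- work with the image `S ⊆ E4`
  set S : Set E4 := Subtype.val '' lensK M a with hS
  have hSmem : ∀ x : E4, x ∈ S ↔ M < Kerr.radius a x ∧ 0 < 6 * M - 2 * Kerr.radius a x - 3 * x 0 ∧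
      0 < 6 * M - 2 * Kerr.radius a x + 3 * x 0 ∧ 0 < 2 * x 0 + (Kerr.radius a x - M) := by
    intro x
    constructor
    · rintro ⟨z, hz, rfl⟩
      exact ⟨Kerr.lt_radius_of_mem_region z.2, hz⟩
    · rintro ⟨h0, h1⟩
      have hmem : x ∈ Kerr.region a M := by rw [Kerr.mem_region, max_eq_left hM.le]; exact h0
      exact ⟨⟨x, hmem⟩, h1, rfl⟩
  -- the slab set and its base point
  set T : Set E4 := E4.ofTimeSpace 0 '' {y : E3 | M < Kerr.radius a (E4.ofTimeSpace 0 y) ∧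
    Kerr.radius a (E4.ofTimeSpace 0 y) < 3 * M} with hT
  have hTc : IsConnected T := (isConnected_shell a hM).image _ (E4.continuous_ofTimeSpace 0).continuousOn
  have hTS : T ⊆ S := by
    rintro _ ⟨y, ⟨h1, h2⟩, rfl⟩
    rw [hSmem]
    simp only [E4.ofTimeSpace_apply_zero, mul_zero, sub_zero, add_zero, zero_add]
    exact ⟨h1, by linarith, by linarith, by linarith⟩
  obtain ⟨x₀, hx₀⟩ := hTc.nonempty
  have hpre : IsPreconnected S := by
    refine isPreconnected_of_forall x₀ fun x hx ↦ ?_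
    rw [hSmem] at hx
    obtain ⟨h0, h1, h2, h3⟩ := hx
    -- the foot point `(0, x⃗)` and the vertical segment
    set f : E4 := E4.ofTimeSpace 0 (E4.spatial x) with hf
    have hrf : ∀ θ : ℝ, Kerr.radius a (f + θ • (x - f)) = Kerr.radius a x := fun θ ↦ by
      have hsp : E4.spatial (f + θ • (x - f)) = E4.spatial x := by
        rw [map_add, map_smul, map_sub, hf, E4.spatial_ofTimeSpace, sub_self, smul_zero, add_zero]
      rw [← Kerr.radius_ofTimeSpace_spatial a (f + θ • (x - f)), hsp, Kerr.radius_ofTimeSpace_spatial]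
    have h0f : ∀ θ : ℝ, (f + θ • (x - f)) 0 = θ * x 0 := fun θ ↦ by
      simp [hf]
    have hfT : f ∈ T := by
      refine ⟨E4.spatial x, ⟨?_, ?_⟩, rfl⟩
      · rw [Kerr.radius_ofTimeSpace_spatial]; exact h0
      · rw [Kerr.radius_ofTimeSpace_spatial]; linarith
    have hseg : segment ℝ f x ⊆ S := by
      rw [segment_eq_image']
      rintro _ ⟨θ, ⟨hθ0, hθ1⟩, rfl⟩
      rw [hSmem, hrf θ, h0f θ]
      refine ⟨h0, ?_, ?_, ?_⟩
      · nlinarith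
      · nlinarith
      · rcases le_or_gt 0 (x 0) with hx | hx
        · nlinarith [mul_nonneg hθ0 hx]
        · nlinarith [mul_nonneg (sub_nonneg.2 hθ1) (neg_nonneg.2 hx.le)]
    refine ⟨T ∪ segment ℝ f x, union_subset hTS hseg, Or.inl hx₀, Or.inr (right_mem_segment _ _ _), ?_⟩
    exact hTc.isPreconnected.union f hfT (left_mem_segment _ _ _) (convex_segment _ _).isPreconnected
  refine ⟨?_, IsInducing.subtypeVal.isPreconnected_image.mp hpre⟩
  obtain ⟨z, hz, -⟩ := hTS hx₀
  exact ⟨z, hz⟩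

end Connected

end F1Route

/-- **Registered bookkeeping sub-goal `stub_slabLensConnected` of the line** (brick of the landing
of F1' `stub_slabCauchyRigidity'`): the connectedness clauses of route statement (C)
`F1Route.KerrSlabLensCauchy` — for `0 < M` the open thick slab `slabW M a` of the Kerr–Schild slice
and its lens `lensK M a` in the star chart are connected. [cite: ONeill1995, Ch. 2 §2.1] -/
theorem stub_slabLensConnected : ∀ (M a : ℝ), 0 < M →
    IsConnected (F1Route.slabW M a : Set (Kerr.slice a M)) ∧ IsConnected (F1Route.lensK M a) :=
  fun _ a hM => ⟨F1Route.isConnected_slabW a hM, F1Route.isConnected_lensK a hM⟩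

end Summit.FinalStateConjecture.FinalStateConjecture.Theorems.BondiBartnikRigidity.DirectMethod

end
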